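import Summits.BirchSwinnertonDyer.BirchSwinnertonDyer.Theses.RamifiedSevenEllipticUnits
import Summits.BirchSwinnertonDyer.Rank1Residual.X11b.AnticyclotomicSelmerStructure
import Summits.BirchSwinnertonDyer.Rank1Residual.X11b.AnticyclotomicInfinitePlaces
import Literature.NumberTheory.EllipticCurves.BSDSelmer
import Literature.NumberTheory.EllipticCurves.NeronOggShafarevichLocal
import Literature.NumberTheory.EllipticCurves.GeomPointsGaloisModule
import Literature.NumberTheory.NumberFields.OddDegreeUnramifiedNoQuadraticSubfield
import HarnessLib

set_option linter.dupNamespace false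
set_option autoImplicit false

/-!
# Route `RamifiedSevenEllipticUnits` (rung K7r), crux `StrictControlSeven` (stmt-BirchSwinnertonDyer-19145):
# Castella's Selmer group over `K` versus the everywhere-strict classical conditions (brick (s6))

Cell `bsd-cm`, seat `bsd-cm-k7r-c4` (g0). HONEST FRAMING: nothing here closes the crux; BSD is not
proved by any of this. The left-hand side of the twist-descent identity (D) (file
`…StrictControlDescent`) is `#Sel_𝔭(K, E[p^∞]) = Nat.card (AcSelmer.selmerAcBase (W⁄K) p 𝔭 ∅)`,
Castella's Selmer group OVER `K` (X11b `AnticyclotomicControlMap`), a subgroup of `H¹(⊤, E[p^∞])`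
cut out by local TRIVIALITY AT DECOMPOSITION GROUPS (`GreenbergSelmer.awayKer`, `infKer`, the strict
condition of the datum `M⁺_𝔭 = 0`). The `±`-decomposition of Dokchitser–Dokchitser (Lemma 4.14)
is run on the classical side: `H¹(K, E[p^∞]) = galH1Primary`, with the strict condition
`selmerLocalKerPrimaryTorsion (W⁄K) K_v p` ("dies in `H¹(K_v, E(K̄_v)[p^∞])`") at every finite
place. This file identifies the two, when `𝔭` is the ONLY prime of `K` above `p` (the ramified
frame: `p 𝓞_K = 𝔭²`) and `K` is totally complex (imaginary quadratic):

  `#Sel_𝔭(K, E[p^∞]) = #{c ∈ H¹(K, E[p^∞]) : c ↦ 0 in H¹(K_v, E(K̄_v)[p^∞]) for every finite v}`.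

## What is proved

* `eq_of_mem_of_dvd_discr_of_finrank_eq_two` — in a quadratic field a prime `p ∣ d_K` has a UNIQUE
  prime above it (fundamental identity `Σ e f = 2` with `e = 2`,
  `ramificationIdx_eq_two_of_dvd_discr_of_finrank_eq_two`).
* `primaryPointsMap_bijective` — `E[p^∞](K̄) → E(K̄_E)[p^∞]` is bijective for EVERY `K`-field `E`
  (all torsion is algebraic: `exists_pointsMapOfEmb_eq_of_nsmul_eq_zero`, Silverman III.6.4(b)).
* `mem_selmerLocalKerPrimaryTorsion_iff_resSubgroup_range_eq_zero` — hence the strict condition at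
  `E` is "dies on the SUBGROUP `range (Γ_E → Γ_K)`" (`LocBridge.resH1Hom_eq_zero_iff_of_range_eq`:
  with bijective coefficients the kernel depends only on the range); at a finite place this range
  is `GreenbergSelmer.decomp v`, at an infinite place `decompInf w`.
* `resSubgroup_eq_zero_of_eq_bot` — restriction to the trivial subgroup kills every class; so at a
  COMPLEX place (`decompInf w = ⊥`, X11b `decompInf_eq_bot_of_isComplex`) the strict condition is
  vacuous (`selmerLocalKerPrimaryTorsion_completion_eq_top_of_isComplex`).
* **`resH1Hom_top_mem_selmerAcBase_iff`, `natCard_selmerAcBase_eq_natCard_iInf`** — the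
  identification and its `Nat.card` form.

References: [Castella2018] Def. 2.2 (arXiv:1704.06608 p. 5); [Greenberg1989] §1 p. 98;
[GreenbergLNM1716] §2–3; [SerreGaloisCohomology1997] I.§2.4–2.5, I.§5.1, II.§1.1;
[SilvermanAEC2009] Cor. III.6.4(b); [NeukirchANT1999] Ch. I §8 (fundamental identity).
-/

noncomputable section

open scoped Classical

open WeierstrassCurve CategoryTheory NumberField IsDedekindDomain Field
  Literature.NumberTheory.EllipticCurves
  Literature.NumberTheory.EllipticCurves.GreenbergSelmer
  Literature.NumberTheory.GaloisRepresentations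
  Summit.BirchSwinnertonDyer.Rank1Residual.X11b
  Summit.BirchSwinnertonDyer.Rank1Residual.X11b.LocBridge
  Summit.BirchSwinnertonDyer.Rank1Residual.X11b.AcSelmer

universe u

namespace Summit.BirchSwinnertonDyer.BirchSwinnertonDyer.Theorems.RamifiedSevenEllipticUnits

/-! ## §1 A ramified prime of a quadratic field has a unique prime above it -/

/-- **In a quadratic field `K`, a rational prime `p ∣ d_K` has exactly one prime above it**: every
prime `𝔮 ∣ p` has `e(𝔮|p) = 2` (`ramificationIdx_eq_two_of_dvd_discr_of_finrank_eq_two`), and the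
fundamental identity `Σ_{𝔮 ∣ p} e(𝔮|p) f(𝔮|p) = [K : ℚ] = 2` leaves room for one prime only.
[cite: NeukirchANT1999, Ch. I §8 Prop. (8.2) (fundamental identity)] -/
theorem eq_of_mem_of_dvd_discr_of_finrank_eq_two {K : Type u} [Field K] [NumberField K]
    (hK : Module.finrank ℚ K = 2) {p : ℕ} (hp : p.Prime) (hdvd : (p : ℤ) ∣ NumberField.discr K)
    {v v' : HeightOneSpectrum (𝓞 K)} (hv : ((p : ℕ) : 𝓞 K) ∈ v.asIdeal)
    (hv' : ((p : ℕ) : 𝓞 K) ∈ v'.asIdeal) : v = v' := by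
  classical
  by_contra hne
  have hpZ : Prime (p : ℤ) := Nat.prime_iff_prime_int.mp hp
  haveI hpmax : (Ideal.span {(p : ℤ)}).IsMaximal :=
    ((Ideal.span_singleton_prime hpZ.ne_zero).mpr hpZ).isMaximal
      (by rw [Ne, Ideal.span_singleton_eq_bot]; exact hpZ.ne_zero)
  haveI := v.isMaximal
  haveI := v'.isMaximal
  -- both primes lie over `(p)`
  have hover : ∀ {w : HeightOneSpectrum (𝓞 K)}, ((p : ℕ) : 𝓞 K) ∈ w.asIdeal →
      w.asIdeal.LiesOver (Ideal.span {(p : ℤ)}) := fun {w} hw ↦ by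
    haveI := w.isMaximal
    refine ⟨hpmax.eq_of_le (Ideal.comap_ne_top _ w.isMaximal.ne_top) ?_⟩
    rw [Ideal.span_le, Set.singleton_subset_iff, SetLike.mem_coe, Ideal.mem_comap, map_natCast]
    exact hw
  haveI h1 := hover hv
  haveI h2 := hover hv'
  have he : v.asIdeal.ramificationIdx ℤ = 2 :=
    Literature.NumberTheory.NumberFields.ramificationIdx_eq_two_of_dvd_discr_of_finrank_eq_two
      hK hpZ hdvd v.asIdeal
  have he' : v'.asIdeal.ramificationIdx ℤ = 2 :=
    Literature.NumberTheory.NumberFields.ramificationIdx_eq_two_of_dvd_discr_of_finrank_eq_two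
      hK hpZ hdvd v'.asIdeal
  have hf : 0 < v.asIdeal.inertiaDeg ℤ := Ideal.inertiaDeg_pos v.asIdeal ℤ
  have hf' : 0 < v'.asIdeal.inertiaDeg ℤ := Ideal.inertiaDeg_pos v'.asIdeal ℤ
  -- the fundamental identity `Σ e f = 2`
  have hsum := Ideal.sum_ramification_inertia_eq_finrank (Ideal.span {(p : ℤ)}) (𝓞 K)
  rw [NumberField.RingOfIntegers.rank, hK] at hsum
  let a : (Ideal.span {(p : ℤ)}).primesOver (𝓞 K) := ⟨v.asIdeal, v.isPrime, h1⟩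
  let b : (Ideal.span {(p : ℤ)}).primesOver (𝓞 K) := ⟨v'.asIdeal, v'.isPrime, h2⟩
  have hab : a ≠ b := fun h ↦ hne (HeightOneSpectrum.ext (congrArg Subtype.val h))
  have hle : ∑ x ∈ ({a, b} : Finset ((Ideal.span {(p : ℤ)}).primesOver (𝓞 K))),
      x.1.ramificationIdx ℤ * x.1.inertiaDeg ℤ ≤ 2 := by
    rw [← hsum]
    exact Finset.sum_le_sum_of_subset (Finset.subset_univ _)
  rw [Finset.sum_pair hab] at hle
  change v.asIdeal.ramificationIdx ℤ * v.asIdeal.inertiaDeg ℤ +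
    v'.asIdeal.ramificationIdx ℤ * v'.asIdeal.inertiaDeg ℤ ≤ 2 at hle
  rw [he, he'] at hle
  omega

/-! ## §2 All `p`-power torsion of `E(K̄_E)` is algebraic: `E[p^∞](K̄) ≅ E(K̄_E)[p^∞]` -/

section Local

variable {K : Type u} [Field K] [CharZero K] (W : WeierstrassCurve K) [W.IsElliptic] (p : ℕ)
  [hp : Fact p.Prime] (E : Type u) [Field E] [Algebra K E]

/-- **`primaryPointsMap : E[p^∞](K̄) → E(K̄_E)[p^∞]` is bijective** for every `K`-field `E`
(`char K = 0`): injective as a restriction of the injective `ι_*` (`pointsMapOfEmb_injective`),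
surjective because every `p^k`-torsion point of `E(K̄_E)` is `ι_* P` for a `p^k`-torsion point
`P ∈ E(K̄)` (`exists_pointsMapOfEmb_eq_of_nsmul_eq_zero`: `#E[m] = m²` over both algebraically closed
fields, Silverman III.6.4(b)). [cite: SilvermanAEC2009, Cor. III.6.4(b)] -/
theorem primaryPointsMap_bijective : Function.Bijective (primaryPointsMap W E p) := by
  refine ⟨fun P Q h ↦ Subtype.ext
      (pointsMapOfEmb_injective W (closureEmb (K := K) E) (congrArg Subtype.val h)), fun Q ↦ ?_⟩
  obtain ⟨k, hk⟩ := (AddCommGroup.mem_primaryComponent).mp Q.2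
  obtain ⟨P, hP, hPQ⟩ := exists_pointsMapOfEmb_eq_of_nsmul_eq_zero W (closureEmb (K := K) E)
    (pow_ne_zero k hp.out.ne_zero) hk
  exact ⟨⟨P, (AddCommGroup.mem_primaryComponent).mpr ⟨k, hP⟩⟩, Subtype.ext hPQ⟩

/-- **The strict condition at `E` is restriction to the subgroup `range (Γ_E → Γ_K) ≤ Γ_K`.** A
class `x ∈ H¹(K, E[p^∞])` dies in `H¹(E, E(K̄_E)[p^∞])` (along the pair `(resGal E, primaryPointsMap)`,
`selmerLocalKerPrimaryTorsion`) iff its restriction to the SUBGROUP `range (resGal E)` of `Γ_K`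
vanishes in `H¹(range, E[p^∞])` (`ResKernel.resSubgroup`): the coefficient map is bijective
(`primaryPointsMap_bijective`), so the kernel depends only on the range of the group map
(`LocBridge.resH1Hom_eq_zero_iff_of_range_eq` — inflation along the surjection `Γ_E ↠ range` is
injective on `H¹`). [cite: SerreGaloisCohomology1997, I.§2.4 and I.§5.1] [cite: GreenbergLNM1716, §2] -/
theorem mem_selmerLocalKerPrimaryTorsion_iff_resSubgroup_range_eq_zero (x : W.galH1Primary p) :
    x ∈ selmerLocalKerPrimaryTorsion W E p ↔
      ResKernel.resSubgroup (resGal (K := K) E).toMonoidHom.range (W.geomPrimaryTorsion p) x = 0 := by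
  rw [selmerLocalKerPrimaryTorsion, resKer_eq_ker, AddMonoidHom.mem_ker, ResKernel.resSubgroup]
  refine resH1Hom_eq_zero_iff_of_range_eq (resGal (K := K) E) (primaryPointsMap W E p)
    (primaryPointsMap_smul W E p) (primaryPointsMap_bijective W p E) (Literature.NumberTheory.EllipticCurves.subgroupIncl _)
    (AddMonoidHom.id _) (fun _ _ ↦ rfl) Function.bijective_id ?_ x
  rw [range_subgroupIncl, MonoidHom.coe_range]
  rfl

end Local

/-! ## §3 Restriction to the trivial subgroup; complex places -/

section Trivial

variable {G : Type u} [Group G] [TopologicalSpace G] [IsTopologicalGroup G]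
variable {M : Type u} [AddCommGroup M] [DistribMulAction G M] [TopologicalSpace M]
  [DiscreteTopology M]

/-- **Restriction to the trivial subgroup kills every class of `H¹(G, M)`**: a crossed
homomorphism vanishes at `1` (`contOneCocycles.apply_one`), so it is principal on `⊥`
(`LocBridge.resSubgroup_oneCocycleClass_eq_zero_iff` with `x = 0`).
[cite: SerreGaloisCohomology1997, I.§2.5 and I.§5.1] -/
theorem resSubgroup_eq_zero_of_eq_bot {D : Subgroup G} (hD : D = ⊥) (x : discreteH1 G M) :
    ResKernel.resSubgroup D M x = 0 := by
  obtain ⟨φ, rfl⟩ := oneCocycleClass_surjective _ x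
  rw [resSubgroup_oneCocycleClass_eq_zero_iff]
  refine ⟨0, fun d hd ↦ ?_⟩
  rw [hD, Subgroup.mem_bot] at hd
  rw [hd, contOneCocycles.apply_one, smul_zero, sub_zero]

end Trivial

section Complex

variable {K : Type} [Field K] [NumberField K] (W : WeierstrassCurve K) [W.IsElliptic] (p : ℕ)
  [Fact p.Prime]

/-- **At a complex place the strict condition is vacuous**: `K_w ≅ ℂ` is algebraically closed, so
`Γ_{K_w}` and its image `decompInf w ≤ Γ_K` are trivial (X11b `decompInf_eq_bot_of_isComplex`),
and every class of `H¹(K, E[p^∞])` dies in `H¹(K_w, E(K̄_w)[p^∞])`.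
[cite: GreenbergLNM1716, §3 p. 87 (archimedean primes)] -/
theorem selmerLocalKerPrimaryTorsion_completion_eq_top_of_isComplex {w : InfinitePlace K}
    (hw : w.IsComplex) : selmerLocalKerPrimaryTorsion W w.Completion p = ⊤ := by
  rw [eq_top_iff]
  intro x _
  rw [mem_selmerLocalKerPrimaryTorsion_iff_resSubgroup_range_eq_zero]
  refine resSubgroup_eq_zero_of_eq_bot ?_ x
  rw [resGal_eq_absGaloisRestrict]
  exact decompInf_eq_bot_of_isComplex hw

end Complex

/-! ## §4 Castella's `Sel_𝔭(K, E[p^∞])` is the everywhere-strict subgroup of `H¹(K, E[p^∞])` -/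

section Bridge

variable {K : Type} [Field K] [NumberField K] (W : WeierstrassCurve K) [W.IsElliptic] (p : ℕ)
  [hp : Fact p.Prime] (𝔭 : HeightOneSpectrum (𝓞 K))

/-- The strict condition at a finite place `v` is "dies on the decomposition group
`GreenbergSelmer.decomp v`" (`decomp v` is by definition the range of `Γ_{K_v} → Γ_K`, which is
`resGal K_v`, `resGal_eq_absGaloisRestrict`). [cite: Greenberg1989, §1 p. 98] [cite: GreenbergLNM1716, §2] -/
theorem mem_selmerLocalKerPrimaryTorsion_adicCompletion_iff (v : HeightOneSpectrum (𝓞 K))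
    (x : W.galH1Primary p) :
    x ∈ selmerLocalKerPrimaryTorsion W (v.adicCompletion K) p ↔
      ResKernel.resSubgroup (decomp v) (W.geomPrimaryTorsion p) x = 0 := by
  rw [mem_selmerLocalKerPrimaryTorsion_iff_resSubgroup_range_eq_zero, resGal_eq_absGaloisRestrict]
  rfl

/-- **Castella's Selmer group over `K` is the everywhere-strict subgroup.** Let `K` be a totally
complex number field, `E = W/K` an elliptic curve, `p` a prime and `𝔭` the ONLY prime of `K` above
`p`. Under `H¹(K, E[p^∞]) ≅ H¹(⊤, E[p^∞])` (restriction along `⊤ ↪ Γ_K`, `LocBridge.topEquivH1`), a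
class `x` lands in `AcSelmer.selmerAcBase W p 𝔭 ∅ = Sel_𝔭(K, E[p^∞])` (Castella Def. 2.2 over `K`:
trivial at the decomposition group of every finite `v ∤ p` and of every infinite place, strict at
`𝔭`, no condition at the other primes above `p` — there are none) iff `x` dies in
`H¹(K_v, E(K̄_v)[p^∞])` for EVERY finite place `v` (`AcSelmer.mem_selmerOver_top_iff`, the three
`LocBridge.topEquivH1_mem_*_iff`, `mem_selmerLocalKerPrimaryTorsion_adicCompletion_iff`; the
infinite conditions are vacuous at complex places, `decompInf_eq_bot_of_isComplex`).
[cite: Castella2018, Def. 2.2 (arXiv:1704.06608 p. 5)] [cite: GreenbergLNM1716, §2–3] -/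
theorem resH1Hom_top_mem_selmerAcBase_iff [IsTotallyComplex K]
    (h𝔭 : ∀ v : HeightOneSpectrum (𝓞 K), ((p : ℕ) : 𝓞 K) ∈ v.asIdeal → v = 𝔭)
    (x : W.galH1Primary p) :
    resH1Hom (Literature.NumberTheory.EllipticCurves.subgroupIncl (⊤ : Subgroup (absoluteGaloisGroup K)))
        (AddMonoidHom.id (W.geomPrimaryTorsion p)) (fun _ _ ↦ rfl) x ∈ selmerAcBase W p 𝔭 ∅ ↔
      x ∈ ⨅ v : HeightOneSpectrum (𝓞 K), selmerLocalKerPrimaryTorsion W (v.adicCompletion K) p := by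
  have key : resH1Hom (Literature.NumberTheory.EllipticCurves.subgroupIncl (⊤ : Subgroup (absoluteGaloisGroup K)))
      (AddMonoidHom.id (W.geomPrimaryTorsion p)) (fun _ _ ↦ rfl) x =
      topEquivH1 (isOpen_stabilizer_geomPrimaryTorsion W p)
        ((toDiscreteH1 (isOpen_stabilizer_geomPrimaryTorsion W p)).symm x) := rfl
  rw [key, selmerAcBase, mem_selmerOver_top_iff, AddSubgroup.mem_iInf]
  simp only [topEquivH1_mem_awayKer_iff, topEquivH1_mem_infKer_iff,
    topEquivH1_mem_strictKer_strictDatum_iff, AddEquiv.apply_symm_apply,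
    ← mem_selmerLocalKerPrimaryTorsion_adicCompletion_iff]
  constructor
  · rintro ⟨hA, -, hS⟩ v
    by_cases hv : ((p : ℕ) : 𝓞 K) ∈ v.asIdeal
    · rw [h𝔭 v hv]
      exact hS
    · exact hA v hv (Set.notMem_empty v)
  · intro h
    refine ⟨fun v _ _ ↦ h v, fun w ↦ ?_, h 𝔭⟩
    exact resSubgroup_eq_zero_of_eq_bot
      (decompInf_eq_bot_of_isComplex (IsTotallyComplex.isComplex w)) x

/-- **`#Sel_𝔭(K, E[p^∞]) = #(⨅_v strict_v)`** (`Nat.card`, no finiteness needed): the cardinality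
form of `resH1Hom_top_mem_selmerAcBase_iff` (the restriction `H¹(K, ·) → H¹(⊤, ·)` is bijective,
`bijective_resH1Hom_subgroupIncl`). This rewrites the left-hand side of the twist-descent identity
(D) of `…StrictControlDescent` in classical terms.
[cite: Castella2018, Def. 2.2 (arXiv:1704.06608 p. 5)] [cite: GreenbergLNM1716, §2–3] -/
theorem natCard_selmerAcBase_eq_natCard_iInf [IsTotallyComplex K]
    (h𝔭 : ∀ v : HeightOneSpectrum (𝓞 K), ((p : ℕ) : 𝓞 K) ∈ v.asIdeal → v = 𝔭) :
    Nat.card (selmerAcBase W p 𝔭 ∅) =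
      Nat.card ↥(⨅ v : HeightOneSpectrum (𝓞 K),
        selmerLocalKerPrimaryTorsion W (v.adicCompletion K) p) := by
  let e : W.galH1Primary p ≃+ W.subgroupH1 p (⊤ : Subgroup (absoluteGaloisGroup K)) :=
    AddEquiv.ofBijective
      (resH1Hom (Literature.NumberTheory.EllipticCurves.subgroupIncl (⊤ : Subgroup (absoluteGaloisGroup K)))
        (AddMonoidHom.id (W.geomPrimaryTorsion p)) (fun _ _ ↦ rfl))
      (bijective_resH1Hom_subgroupIncl (W.geomPrimaryTorsion p) ⊤ Subgroup.mem_top)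
  symm
  refine Nat.card_congr (e.toEquiv.subtypeEquiv fun x ↦ ?_)
  exact (resH1Hom_top_mem_selmerAcBase_iff W p 𝔭 h𝔭 x).symm

end Bridge

end Summit.BirchSwinnertonDyer.BirchSwinnertonDyer.Theorems.RamifiedSevenEllipticUnits

end
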